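import Literature.MeasureTheory.Group.InvariantQuotientNormalized
import Literature.MeasureTheory.Group.InvariantQuotientConjugacySumSubset
import HarnessLib

/-!
# The geometric side over a conjugation-stable SUBSET of `Γ`, with the printed constants:
`∫_{G ⧸ L} Σ_{s ∈ S} F(x s x⁻¹) dμ = c_μ · Σ_{[γ] ⊆ S} vol(G_γ ⧸ H_γ) · ∫_{G ⧸ G_γ} F(y γ y⁻¹) d(ν/ν_γ)`
(Gelbart, *Automorphic forms on adele groups* (1975), (9.11)–(9.13), Remark 9.23, Thm. 9.22 (ii);
Arthur, *A trace formula for reductive groups I*, Duke Math. J. 45 (1978), §8 — one class `𝔬` of the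
`𝔬`-expansion)

Topic `MeasureTheory/Group`; namespace `Literature.MeasureTheory.Group`. THEOREMS ONLY (no definition,
no named fact, no instance, no notation, no `sorry`) over the accepted
★ `InvariantQuotientNormalized` (the per-class brick WITH the printed constant,
`lintegral_conjTsum_conjOrbit_eq_covol_mul`) and ★ `InvariantQuotientConjugacySumSubset` (the class
split of the sum over a conjugation-stable subset, `conjTsum_subset_eq_tsum_conjOrbit`, and its assembly
`exists_lintegral_conjTsum_subset_eq_tsum` ∕ `exists_integral_conjTsum_subset_eq_tsum_complex` with
UNSPECIFIED constants `d_c ∈ (0, ∞)`). This file is the subset twin of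
★ `lintegral_conjTsum_eq_mul_tsum_covol_mul` (all classes) and of
★ `lintegral_conjTsum_mk_mem_eq_mul_tsum_covol_mul` (`InvariantQuotientNormalizedPartial`, a family of
classes `𝒞`, subset `Γ_𝒞`), in the SUBSET-FIRST indexing of ★ `InvariantQuotientConjugacySumSubset`
(`S ⊆ Γ` stable under `L`, classes `{c // ↑(rep c) ∈ S}` — the letters in which a fibre
`{γ | cl γ = 𝔬}` of a class map arrives):

* `lintegral_conjTsum_subset_eq_mul_tsum_covol_mul` — `[0, ∞]`-valued: the constants ARE
  `c_μ · vol(G_c ⧸ H_c)`, `c_μ = unfoldingConstant L ρ_L μ ν` (Weil's constant of `μ`, `= 1` for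
  `μ = ν/ρ_L`), `vol(G_c ⧸ H_c)` the total mass of `quotientMeasure (H_c ⊓ G_c) ρ_{F,c} ν_c`, the orbital
  measures `ν/ν_c = quotientMeasure G_c ν_c ν` (Weil constant one); compactness `G_c ⧸ H_c` is asked ONLY
  of the classes inside `S`;
* `mul_quotientMeasure_univ_ne_zero` — these constants are non-zero (and the covolumes finite);
* `integral_conjTsum_subset_eq_mul_tsum_covol_mul` — the same for complex integrands with
  `∫⁻ Σ'_{s ∈ S} ‖F(x s x⁻¹)‖ dμ < ∞`: integrability, absolute convergence of the class series and the
  identity with `c_μ` pulled out (★ `integral_conjTsum_eq_tsum_of_lintegral_complex`).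

Consumer: the elliptic terms of Arthur's truncated trace for the quasi-split unitary group
(`UnitaryGroupKernelClassOrbitalUnfolding`: `J^T_𝔬(f) = c_μ Σ_{[γ] ⊆ 𝔬} vol · Φ(γ, f)`).

## References
* S. Gelbart, *Automorphic forms on adele groups*, Ann. of Math. Stud. 83 (1975), (9.11)–(9.13) p. 118,
  Thm. 9.22 (ii), Remark 9.23 p. 140 [Gelbart1975].
* J. Arthur, *A trace formula for reductive groups I*, Duke Math. J. 45 (1978), §8
  [Arthur1978TraceFormulaI].
-/

set_option autoImplicit false

noncomputable section

open _root_.MeasureTheory _root_.MeasureTheory.Measure _root_.Topology Set Filter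
open scoped ENNReal NNReal Pointwise

/- The coset spaces carry the Borel structures supplied as instance BINDERS (which take precedence
over Mathlib's quotient σ-algebra instance in every statement below), as in the accepted files. -/

namespace Literature.MeasureTheory.Group

section AssemblyNormalizedSubset

variable {G : Type*} [Group G] [TopologicalSpace G] [IsTopologicalGroup G] [LocallyCompactSpace G]
  [SecondCountableTopology G] [T2Space G] [MeasurableSpace G] [BorelSpace G]
  (Γ L : Subgroup G) [hL : IsClosed (L : Set G)] [Countable Γ] (hΓL : Γ ≤ L)
  (hLΓ : ∀ ℓ ∈ L, ∃ γ ∈ Γ, γ⁻¹ * ℓ ∈ Subgroup.centralizer (Γ : Set G))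
  (rep : ConjClasses Γ → Γ) (hrep : ∀ c, ConjClasses.mk (rep c) = c)
  {S : Set G} (hSΓ : S ⊆ Γ) (hS : ∀ ℓ ∈ L, ∀ s ∈ S, ℓ * s * ℓ⁻¹ ∈ S)
  (Hc Gc : {c : ConjClasses Γ // ((rep c : Γ) : G) ∈ S} → Subgroup G)
  [hHcl : ∀ c, IsClosed ((Hc c : Subgroup G) : Set G)]
  (hHc : ∀ c g, g ∈ Hc c ↔ g ∈ L ∧ g * (rep c.1 : G) = (rep c.1 : G) * g)
  (hHG : ∀ c, Hc c ≤ Gc c) (hGc : ∀ c, ∀ g ∈ Gc c, g * (rep c.1 : G) = (rep c.1 : G) * g)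
  [hGcl : ∀ c, IsClosed ((Gc c : Subgroup G) : Set G)]
  [MeasurableSpace (G ⧸ L)] [BorelSpace (G ⧸ L)]
  [∀ c, MeasurableSpace (G ⧸ Gc c)] [∀ c, BorelSpace (G ⧸ Gc c)]
  [∀ c, MeasurableSpace (Gc c ⧸ (Hc c).subgroupOf (Gc c))]
  [∀ c, BorelSpace (Gc c ⧸ (Hc c).subgroupOf (Gc c))]
  (μ : Measure (G ⧸ L)) [SMulInvariantMeasure G (G ⧸ L) μ] [IsFiniteMeasureOnCompacts μ]
  (ν : Measure G) [IsHaarMeasure ν] [ν.IsMulRightInvariant]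
  (ρL : Measure L) [IsHaarMeasure ρL] [SFinite ρL]
  (ρH : ∀ c, Measure (Hc c)) [∀ c, IsHaarMeasure (ρH c)] [∀ c, (ρH c).IsInvInvariant]
  [∀ c, SFinite (ρH c)]
  (ρF : ∀ c, Measure ((Hc c).subgroupOf (Gc c))) [∀ c, IsHaarMeasure (ρF c)]
  [∀ c, (ρF c).IsInvInvariant] [∀ c, SFinite (ρF c)]
  (νC : ∀ c, Measure (Gc c)) [∀ c, IsHaarMeasure (νC c)] [∀ c, (νC c).IsMulRightInvariant]
  [∀ c, (νC c).IsInvInvariant] [∀ c, SFinite (νC c)]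

include hΓL hLΓ hrep hSΓ hHc in
/-- **The geometric side over a conjugation-stable subset `S ⊆ Γ`, with the printed constants**
(Gelbart (1975), (9.13) and Thm. 9.22 (ii): `Σ_{γ ∈ {G_e}} meas(Z_∞⁺ G(γ)_ℚ \ G(γ)_𝔸)
∫_{G(γ)_𝔸 \ G_𝔸} f(x⁻¹ γ x) dx`; Arthur (1978), §8 for one class `𝔬`). Setting: `G` locally compact
second countable Hausdorff, `Γ ≤ L ≤ G` with `L` closed, `Γ` countable and `L = Γ · C_L(Γ)`, `S ⊆ Γ` stable
under `L`-conjugation; for each conjugacy class `c` of `Γ` INSIDE `S` a representative `γ_c = rep c`, the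
closed subgroup `H_c = L ∩ C_G(γ_c)` (relatively open in `L`), a closed subgroup `G_c ⊇ H_c` centralising
`γ_c` with `G_c ⧸ H_c` compact; a `G`-invariant Borel measure `μ ≠ 0` on `G ⧸ L` finite on compact sets;
Haar measures `ν` on `G` (two-sided), `ρ_L` on `L`, `ν_c` on `G_c` (two-sided, inversion invariant);
`ρ_{H,c} = ρ_L ∘ ι` the restriction of `ρ_L` to `H_c` and `ρ_{F,c}` its transport to `H_c ≤ G_c`. Then
for every Borel `F : G → [0, ∞]`

  `∫_{G ⧸ L} Σ'_{s ∈ S} F(x s x⁻¹) dμ(x)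
     = c_μ · Σ'_{c : γ_c ∈ S} vol(G_c ⧸ H_c) · ∫_{G ⧸ G_c} F(y γ_c y⁻¹) d(ν/ν_c)(y)`,

`c_μ = unfoldingConstant L ρ_L μ ν` (`= 1` for `μ = ν/ρ_L`), `ν/ν_c = quotientMeasure G_c ν_c ν`,
`vol(G_c ⧸ H_c) = quotientMeasure (H_c ⊓ G_c) ρ_{F,c} ν_c (⊤)`; nothing is assumed about the classes
outside `S` (★ `conjTsum_subset_eq_tsum_conjOrbit` + ★ `lintegral_conjTsum_conjOrbit_eq_covol_mul` class
by class). This is ★ `exists_lintegral_conjTsum_subset_eq_tsum` with its constants `d_c` identified.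
[cite: Gelbart1975, (9.13) and Thm. 9.22 (ii)] [cite: Arthur1978TraceFormulaI, §8] -/
theorem lintegral_conjTsum_subset_eq_mul_tsum_covol_mul
    (hopen : ∀ c, IsOpen (((Hc c).subgroupOf L : Subgroup L) : Set L))
    [∀ c, CompactSpace (Gc c ⧸ (Hc c).subgroupOf (Gc c))] (hμ : μ ≠ 0)
    (hρH : ∀ c, ρH c = ρL.comap (Subgroup.inclusion (le_of_mem_iff L (Hc c) (hHc c))))
    (hρF : ∀ c, ρF c = Measure.map (Subgroup.subgroupOfEquivOfLe (hHG c)).symm (ρH c))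
    {F : G → ℝ≥0∞} (hF : Measurable F) :
    ∫⁻ x, conjTsum L S hS F x ∂μ =
      unfoldingConstant L ρL μ ν * ∑' c,
        quotientMeasure ((Hc c).subgroupOf (Gc c)) (ρF c) (isClosed_subgroupOf _ _ (hHcl c))
            (νC c) Set.univ *
          ∫⁻ y, descConj (rep c.1 : G) (Gc c) (hGc c) F y
            ∂quotientMeasure (Gc c) (νC c) (hGcl c) ν := by
  have key := fun c : {c : ConjClasses Γ // ((rep c : Γ) : G) ∈ S} =>
    lintegral_conjTsum_conjOrbit_eq_covol_mul Γ L hΓL hLΓ (rep c.1).2 (Hc c) (Gc c) (hHc c) (hHG c)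
      (hGc c) μ ν ρL (ρH c) (ρF c) (νC c) (hopen c) hμ (hρH c) (hρF c) hF
  have h1 : ∀ x, conjTsum L S hS F x =
      ∑' c : {c : ConjClasses Γ // ((rep c : Γ) : G) ∈ S}, conjTsum L (conjOrbit Γ (rep c.1 : G))
        (conj_mem_conjOrbit_of_exists Γ L hLΓ (rep c.1).2) F x :=
    conjTsum_subset_eq_tsum_conjOrbit Γ L hΓL hLΓ rep hrep hSΓ hS F
  haveI := countable_conjClasses Γ
  simp_rw [h1]
  rw [lintegral_tsum fun c => ?_, ← ENNReal.tsum_mul_left]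
  · exact tsum_congr fun c => by rw [key c, mul_assoc]
  · haveI := countable_conjOrbit Γ (rep c.1 : G)
    exact (measurable_conjTsum L _ _ hL hF).aemeasurable

omit [Countable Γ] [∀ c, MeasurableSpace (G ⧸ Gc c)] [∀ c, BorelSpace (G ⧸ Gc c)]
  [∀ c, SFinite (ρF c)] [∀ c, (νC c).IsInvInvariant] [∀ c, SFinite (νC c)]
  [ν.IsMulRightInvariant] in
/-- **The printed constants are non-zero** (and the covolumes finite): `c_μ · vol(G_c ⧸ H_c) ≠ 0` for
`μ ≠ 0`, `ρ_L ≠ 0` (★ `unfoldingConstant_pos`) and `G_c ⧸ H_c` compact (the quotient measure is a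
non-zero Radon measure); `vol(G_c ⧸ H_c) < ∞`. [cite: Gelbart1975, Remark 9.23] -/
theorem mul_quotientMeasure_univ_ne_zero
    [∀ c, CompactSpace (Gc c ⧸ (Hc c).subgroupOf (Gc c))]
    (hμ : μ ≠ 0) (hρL : ρL ≠ 0) (c : {c : ConjClasses Γ // ((rep c : Γ) : G) ∈ S}) :
    (unfoldingConstant L ρL μ ν : ℝ≥0∞) *
        quotientMeasure ((Hc c).subgroupOf (Gc c)) (ρF c) (isClosed_subgroupOf _ _ (hHcl c))
          (νC c) Set.univ ≠ 0 ∧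
      quotientMeasure ((Hc c).subgroupOf (Gc c)) (ρF c) (isClosed_subgroupOf _ _ (hHcl c))
          (νC c) Set.univ ≠ ∞ :=
  ⟨mul_ne_zero (ENNReal.coe_ne_zero.2 (unfoldingConstant_pos L ρL μ ν hμ hρL).ne')
      (Measure.measure_univ_ne_zero.2 (quotientMeasure_ne_zero _ (ρF c) _ (νC c))),
    (isCompact_univ.measure_lt_top (μ := quotientMeasure ((Hc c).subgroupOf (Gc c)) (ρF c)
      (isClosed_subgroupOf _ _ (hHcl c)) (νC c))).ne⟩

include hΓL hLΓ hrep hSΓ hHc in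
/-- **The geometric side over a conjugation-stable subset, for complex integrands, with the printed
constants** (Gelbart (1975), (9.13) ∕ Thm. 9.22 (ii), whose `φ` is a complex test function; Arthur
(1978), §8). Under the hypotheses of `lintegral_conjTsum_subset_eq_mul_tsum_covol_mul` and `ρ_L ≠ 0`, for
every Borel `F : G → ℂ` with `∫_{G ⧸ L} Σ'_{s ∈ S} ‖F(x s x⁻¹)‖ dμ < ∞`: the sum over conjugates in `S`
is `μ`-integrable, every orbital integrand `y ↦ F(y γ_c y⁻¹)` is `ν/ν_c`-integrable, the class series
converges absolutely, and

  `∫_{G ⧸ L} Σ'_{s ∈ S} F(x s x⁻¹) dμ(x)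
     = c_μ · Σ'_{c : γ_c ∈ S} vol(G_c ⧸ H_c) · ∫_{G ⧸ G_c} F(y γ_c y⁻¹) d(ν/ν_c)(y)`

(★ `integral_conjTsum_eq_tsum_of_lintegral_complex` with `d_c = c_μ · vol(G_c ⧸ H_c)`, and `c_μ` pulled
out of the absolutely convergent series). [cite: Gelbart1975, (9.13) and Thm. 9.22 (ii)]
[cite: Arthur1978TraceFormulaI, §8] -/
theorem integral_conjTsum_subset_eq_mul_tsum_covol_mul
    (hopen : ∀ c, IsOpen (((Hc c).subgroupOf L : Subgroup L) : Set L))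
    [∀ c, CompactSpace (Gc c ⧸ (Hc c).subgroupOf (Gc c))] (hμ : μ ≠ 0) (hρL : ρL ≠ 0)
    (hρH : ∀ c, ρH c = ρL.comap (Subgroup.inclusion (le_of_mem_iff L (Hc c) (hHc c))))
    (hρF : ∀ c, ρF c = Measure.map (Subgroup.subgroupOfEquivOfLe (hHG c)).symm (ρH c))
    {F : G → ℂ} (hF : Measurable F)
    (hfin : ∫⁻ x, conjTsum L S hS (fun g => (‖F g‖ₑ : ℝ≥0∞)) x ∂μ < ∞) :
    Integrable (conjTsum L S hS F) μ ∧
    (∀ c, Integrable (descConj (rep c.1 : G) (Gc c) (hGc c) F)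
      (quotientMeasure (Gc c) (νC c) (hGcl c) ν)) ∧
    Summable (fun c => (quotientMeasure ((Hc c).subgroupOf (Gc c)) (ρF c)
        (isClosed_subgroupOf _ _ (hHcl c)) (νC c) Set.univ).toReal *
      ∫ y, ‖descConj (rep c.1 : G) (Gc c) (hGc c) F y‖ ∂quotientMeasure (Gc c) (νC c) (hGcl c) ν) ∧
    ∫ x, conjTsum L S hS F x ∂μ =
      ((unfoldingConstant L ρL μ ν : ℝ) : ℂ) * ∑' c,
        ((quotientMeasure ((Hc c).subgroupOf (Gc c)) (ρF c) (isClosed_subgroupOf _ _ (hHcl c))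
            (νC c) Set.univ).toReal : ℂ) *
          ∫ y, descConj (rep c.1 : G) (Gc c) (hGc c) F y ∂quotientMeasure (Gc c) (νC c) (hGcl c) ν := by
  haveI : Countable S :=
    Set.countable_coe_iff.2 ((Set.countable_coe_iff.1 (inferInstance : Countable Γ)).mono hSΓ)
  have hId := fun (F : G → ℝ≥0∞) (hF : Measurable F) =>
    lintegral_conjTsum_subset_eq_mul_tsum_covol_mul Γ L hΓL hLΓ rep hrep hSΓ hS Hc Gc hHc hHG hGc μ ν ρL
      ρH ρF νC hopen hμ hρH hρF hF
  -- the `[0, ∞]`-identity with the constant inside the series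
  have hId' : ∀ F : G → ℝ≥0∞, Measurable F → ∫⁻ x, conjTsum L S hS F x ∂μ =
      ∑' c : {c : ConjClasses Γ // ((rep c : Γ) : G) ∈ S},
        ((unfoldingConstant L ρL μ ν : ℝ≥0∞) *
          quotientMeasure ((Hc c).subgroupOf (Gc c)) (ρF c) (isClosed_subgroupOf _ _ (hHcl c))
            (νC c) Set.univ) *
        ∫⁻ y, descConj (rep c.1 : G) (Gc c) (hGc c) F y ∂quotientMeasure (Gc c) (νC c) (hGcl c) ν := by
    intro F hF
    rw [hId F hF, ← ENNReal.tsum_mul_left]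
    exact tsum_congr fun c => by rw [mul_assoc]
  have hd0 := fun c => (mul_quotientMeasure_univ_ne_zero (Γ := Γ) (L := L) (rep := rep) (Hc := Hc)
    (Gc := Gc) (μ := μ) (ν := ν) (ρL := ρL) (ρF := ρF) (νC := νC) hμ hρL c).1
  obtain ⟨hint, hdesc, hsum, heq⟩ :=
    integral_conjTsum_eq_tsum_of_lintegral_complex L S hS μ (fun c => (rep c.1 : G)) Gc hGc
      (fun c => quotientMeasure (Gc c) (νC c) (hGcl c) ν) hd0 hId' hF hfin
  have hc0 : (0 : ℝ) < unfoldingConstant L ρL μ ν := NNReal.coe_pos.2 (unfoldingConstant_pos L ρL μ ν hμ hρL)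
  have htoReal : ∀ c : {c : ConjClasses Γ // ((rep c : Γ) : G) ∈ S},
      (((unfoldingConstant L ρL μ ν : ℝ≥0∞) *
        quotientMeasure ((Hc c).subgroupOf (Gc c)) (ρF c) (isClosed_subgroupOf _ _ (hHcl c))
          (νC c) Set.univ)).toReal =
      (unfoldingConstant L ρL μ ν : ℝ) *
        (quotientMeasure ((Hc c).subgroupOf (Gc c)) (ρF c) (isClosed_subgroupOf _ _ (hHcl c))
          (νC c) Set.univ).toReal := fun c => by
    rw [ENNReal.toReal_mul, ENNReal.coe_toReal]
  refine ⟨hint, hdesc, ?_, ?_⟩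
  · simp only [htoReal, mul_assoc] at hsum
    exact (summable_mul_left_iff hc0.ne').1 hsum
  · rw [heq, ← tsum_mul_left]
    refine tsum_congr fun c => ?_
    rw [htoReal, Complex.ofReal_mul, mul_assoc]

end AssemblyNormalizedSubset

end Literature.MeasureTheory.Group

end
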